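import Literature.NumberTheory.EllipticCurves.IwasawaSelmerControlCokerProofs
import Literature.NumberTheory.EllipticCurves.GreenbergSelmerDualDataExistsProofs
import Literature.NumberTheory.EllipticCurves.ZpExtensionSubgroupH1TorsionCoefficientsProofs
import Literature.NumberTheory.EllipticCurves.GeomPointsGaloisModule
import HarnessLib

/-!
# `H¹(K_∞, A)` is exhausted by the finite layers: every class comes from `H¹(K_n, A)` for some `n`,
# and every class of `H¹(K_∞, E[p^∞])` is `θ_{n,m}(y)` for some `y ∈ H¹(K_n, E[p^m])` (PROVED)

For a number field `K`, a `ℤ_p`-extension `κ` (`K_∞ = ⋃ K_n`, `Gal(K̄/K_∞) = κ.kerSubgroup`,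
`Gal(K̄/K_n) = κ.layerSubgroup n`) and a discrete `p`-primary `Γ_K`-module `A` whose points have open
stabilisers:

* `ZpExtension.exists_mem_range_resOfLe` — **`H¹(K_∞, A) = ⋃_n res(H¹(K_n, A))`**: every class of
  `subgroupH1 κ.kerSubgroup A` is a restriction from some layer (continuity of the `Γ`-action on the
  discrete module `H¹(K_∞, A)`, `GreenbergSelmer.exists_conjH1_pow_prime_pow_eq`, followed by
  Greenberg's Lemma 3.2 / inflation–restriction surjectivity along the pro-cyclic quotient,
  `ZpExtension.mem_range_resOfLe_of_conjH1_eq`); `exists_mem_range_resOfLe_of_le` — the layer may be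
  taken beyond any given `n₀` (restriction is transitive).
* `WeierstrassCurve.exists_toInfty_eq` — **`H¹(K_∞, E[p^∞]) = ⋃_{n,m} θ_{n,m}(H¹(K_n, E[p^m]))`** for an
  elliptic curve over `K`: every class of `W.subgroupH1 p κ.kerSubgroup` is `AcSigned.toInfty W p κ n m y`
  (coefficient continuity `exists_resH1Hom_inclusion_geomTorsion_eq_of_subgroupH1` + the above for
  `A = E[p^m]`, assembled by `resH1Hom_comp`); `exists_toInfty_eq_of_le` with `n ≥ n₀`, `m ≥ m₀`.

This is the hypothesis "`G = ⋃_i S i`" under which the Pontryagin-dual files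
`Literature/Algebra/InverseSystem/CharacterModuleDirectedUnion(Directed).lean` identify
`Hom(H¹(K_∞, ·), ℚ/ℤ)`-type duals (`AcSigned.X`, …) with compatible families of finite-level duals, and
the source of the "`x_i ∈ range f_i`" inputs of the lifting lemmas of `DirectedSystemLifting.lean`.
All statements are proved; no named facts; no definitions.

References: Greenberg, *Iwasawa theory for elliptic curves*, LNM 1716, §3 Lemma 3.2 (`Coker(h_n) = 0`
over the layers) and §1 (PDF p. 60: the action of `Γ` on `H¹(K_∞, A)` is continuous); Serre, *Galois
Cohomology*, I.§2.2 Prop. 8 (`Hⁱ(lim← G_n, A) = lim→ Hⁱ(G_n, A)` for discrete `A`); Neukirch–Schmidt–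
Wingberg, (1.5.1).
-/

noncomputable section

open scoped Classical

open Literature.NumberTheory.EllipticCurves Literature.NumberTheory.GaloisRepresentations Field

universe u

namespace Literature.NumberTheory.EllipticCurves.ZpExtension

section General

variable {K : Type u} [Field K] [NumberField K] {p : ℕ} [Fact p.Prime] (κ : ZpExtension K p)
  (M : Type u) [AddCommGroup M] [DistribMulAction (absoluteGaloisGroup K) M] [TopologicalSpace M]
  [DiscreteTopology M]

omit [NumberField K] [DiscreteTopology M] in
/-- Orbit maps of a discrete module with open stabilisers are continuous (the fibre over `g₀ • m`
contains the open coset `g₀ · Stab(m)`). [cite: SerreGaloisCohomology1997, I.§2.2 (discrete `G`-modules)] -/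
theorem continuous_smul_of_isOpen_stabilizer'
    (hstab : ∀ m : M, IsOpen (MulAction.stabilizer (absoluteGaloisGroup K) m : Set (absoluteGaloisGroup K)))
    (m : M) : Continuous fun g : absoluteGaloisGroup K ↦ g • m := by
  refine continuous_def.2 fun U _ ↦ isOpen_iff_forall_mem_open.2 fun g₀ hg₀ ↦ ?_
  refine ⟨(fun g ↦ g₀⁻¹ * g) ⁻¹' (MulAction.stabilizer (absoluteGaloisGroup K) m : Set _), ?_, ?_, ?_⟩
  · intro g hg
    have hg' : (g₀⁻¹ * g) • m = m := hg
    show g • m ∈ U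
    rw [show g • m = g₀ • ((g₀⁻¹ * g) • m) by rw [smul_smul, mul_inv_cancel_left], hg']
    exact hg₀
  · exact (hstab m).preimage (continuous_const.mul continuous_id)
  · show (g₀⁻¹ * g₀) • m = m
    rw [inv_mul_cancel, one_smul]

/-- **`H¹(K_∞, A) = ⋃_n res H¹(K_n, A)`**: for a discrete `p`-primary `Γ_K`-module `A` with open point
stabilisers, every class `x ∈ H¹(Gal(K̄/K_∞), A)` is the restriction of a class of `H¹(Gal(K̄/K_n), A)`
for some layer `n`. Proof: `x` is fixed by `conj_{γ^{pⁿ}}` for some `n` (`γ` a topological generator;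
`GreenbergSelmer.exists_conjH1_pow_prime_pow_eq`: continuity of the `Γ`-action), and a class fixed by
`conj_{γ^{pⁿ}}` is a restriction from `K_n` (`mem_range_resOfLe_of_conjH1_eq`: Greenberg's Lemma 3.2,
`H²` of the pro-cyclic quotient vanishing at the cocycle level).
[cite: GreenbergLNM1716, §3 Lemma 3.2 and §1 (PDF p. 60)] [cite: SerreGaloisCohomology1997, I.§2.2 Prop. 8] -/
theorem exists_mem_range_resOfLe
    (hstab : ∀ m : M, IsOpen (MulAction.stabilizer (absoluteGaloisGroup K) m : Set (absoluteGaloisGroup K)))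
    (hprim : ∀ m : M, ∃ k : ℕ, p ^ k • m = 0) (x : subgroupH1 κ.kerSubgroup M) :
    ∃ n : ℕ, x ∈ (resOfLe M (κ.kerSubgroup_le_layerSubgroup n)).range := by
  obtain ⟨γ, hγ⟩ := κ.surjective (Multiplicative.ofAdd 1)
  have hγ' : κ.IsTopGenerator γ := hγ
  obtain ⟨n, hn⟩ := GreenbergSelmer.exists_conjH1_pow_prime_pow_eq κ M hstab hγ' x
  exact ⟨n, mem_range_resOfLe_of_conjH1_eq κ hγ' n (continuous_smul_of_isOpen_stabilizer' M hstab)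
    hprim x hn⟩

/-- The layer in `exists_mem_range_resOfLe` may be taken `≥ n₀` for any `n₀` (restrict further along
`Gal(K̄/K_n) ≤ Gal(K̄/K_{n₀ ⊔ n})`, `resOfLe_comp`). [cite: GreenbergLNM1716, §3 Lemma 3.2] -/
theorem exists_mem_range_resOfLe_of_le
    (hstab : ∀ m : M, IsOpen (MulAction.stabilizer (absoluteGaloisGroup K) m : Set (absoluteGaloisGroup K)))
    (hprim : ∀ m : M, ∃ k : ℕ, p ^ k • m = 0) (n₀ : ℕ) (x : subgroupH1 κ.kerSubgroup M) :
    ∃ n : ℕ, n₀ ≤ n ∧ x ∈ (resOfLe M (κ.kerSubgroup_le_layerSubgroup n)).range := by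
  obtain ⟨n, y, hy⟩ := exists_mem_range_resOfLe κ M hstab hprim x
  refine ⟨max n₀ n, le_max_left _ _,
    resOfLe M (κ.layerSubgroup_antitone (le_max_right n₀ n)) y, ?_⟩
  have h := congrArg (fun f ↦ f y)
    (resOfLe_comp_holds (M := M) (κ.kerSubgroup_le_layerSubgroup (max n₀ n))
      (κ.layerSubgroup_antitone (le_max_right n₀ n)))
  simp only [AddMonoidHom.coe_comp, Function.comp_apply] at h
  rw [h]
  exact hy

end General

end Literature.NumberTheory.EllipticCurves.ZpExtension

namespace WeierstrassCurve

open Literature.NumberTheory.EllipticCurves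

variable {K : Type u} [Field K] [NumberField K] (W : WeierstrassCurve K) [W.IsElliptic] {p : ℕ}
  [Fact p.Prime] (κ : ZpExtension K p)

/-- **`H¹(K_∞, E[p^∞]) = ⋃_{n,m} θ_{n,m}(H¹(K_n, E[p^m]))`**: every class of `H¹(Gal(K̄/K_∞), E[p^∞])` is
`AcSigned.toInfty W p κ n m y` for some layer `n`, some `m` and some `y ∈ H¹(Gal(K̄/K_n), E[p^m])`.
Proof: the class is killed by some `p^m` and then comes from `H¹(K_∞, E[p^m])`
(`exists_resH1Hom_inclusion_geomTorsion_eq_of_subgroupH1`, Kummer theory), which comes from a layer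
(`ZpExtension.exists_mem_range_resOfLe` for the finite discrete module `E[p^m]`); `θ_{n,m}` is the
composite of the two maps (`resH1Hom_comp`). [cite: GreenbergLNM1716, §3 Lemma 3.2 and §2 p. 71]
[cite: SerreGaloisCohomology1997, I.§2.2 Prop. 8] -/
theorem exists_toInfty_eq (s : W.subgroupH1 p κ.kerSubgroup) :
    ∃ (n m : ℕ) (y : W.torsionH1Over ((p : ℤ) ^ m) (κ.layerSubgroup n)), AcSigned.toInfty W p κ n m y = s := by
  obtain ⟨m, -, s', hs'⟩ := W.exists_resH1Hom_inclusion_geomTorsion_eq_of_subgroupH1 κ 0 s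
  have hprim : ∀ P : geomTorsion W ((p : ℤ) ^ m), ∃ k : ℕ, p ^ k • P = 0 := fun P ↦
    ⟨m, Subtype.ext (by
      rw [AddSubgroupClass.coe_nsmul, ZeroMemClass.coe_zero, ← natCast_zsmul, Nat.cast_pow]
      exact P.2)⟩
  obtain ⟨n, y, hy⟩ := ZpExtension.exists_mem_range_resOfLe κ (geomTorsion W ((p : ℤ) ^ m))
    (fun P ↦ isOpen_stabilizer_geomTorsion W _ P) hprim s'
  refine ⟨n, m, y, ?_⟩
  -- `θ_{n,m} = (coefficient inclusion) ∘ (restriction to K_∞)` as maps of compatible pairs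
  have e := resH1Hom_comp (N := geomTorsion W ((p : ℤ) ^ m))
    (subgroupInclusion (κ.kerSubgroup_le_layerSubgroup n)) (AddMonoidHom.id _) (fun _ _ ↦ rfl)
    (P := W.geomPrimaryTorsion p) (ContinuousMonoidHom.id κ.kerSubgroup)
    (AddSubgroup.inclusion (AcSigned.geomTorsion_zpow_le_geomPrimaryTorsion W p m)) (fun _ _ ↦ rfl)
  have e' : AcSigned.toInfty W p κ n m =
      (resH1Hom (ContinuousMonoidHom.id κ.kerSubgroup)
        (AddSubgroup.inclusion (AcSigned.geomTorsion_zpow_le_geomPrimaryTorsion W p m)) (fun _ _ ↦ rfl)).comp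
      (Literature.NumberTheory.EllipticCurves.resOfLe (geomTorsion W ((p : ℤ) ^ m))
        (κ.kerSubgroup_le_layerSubgroup n)) := by
    rw [AcSigned.toInfty, Literature.NumberTheory.EllipticCurves.resOfLe, e]
    exact resH1Hom_congr (ContinuousMonoidHom.ext fun _ ↦ rfl) (AddMonoidHom.ext fun _ ↦ rfl) _ _
  rw [e', AddMonoidHom.comp_apply, hy, hs']

/-- The indices in `exists_toInfty_eq` may be taken beyond any `(n₀, m₀)`: compatibility of `θ` with
restriction between layers (`AcSigned.toInfty_resOfLe`) and with the coefficient maps `p_*`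
is not needed — enlarge `n` by `exists_mem_range_resOfLe_of_le` and `m` through the `k₀`-bound of
`exists_resH1Hom_inclusion_geomTorsion_eq_of_subgroupH1`. [cite: GreenbergLNM1716, §3 Lemma 3.2 and §2 p. 71] -/
theorem exists_toInfty_eq_of_le (n₀ m₀ : ℕ) (s : W.subgroupH1 p κ.kerSubgroup) :
    ∃ (n m : ℕ), n₀ ≤ n ∧ m₀ ≤ m ∧
      ∃ y : W.torsionH1Over ((p : ℤ) ^ m) (κ.layerSubgroup n), AcSigned.toInfty W p κ n m y = s := by
  obtain ⟨m, hm, s', hs'⟩ := W.exists_resH1Hom_inclusion_geomTorsion_eq_of_subgroupH1 κ m₀ s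
  have hprim : ∀ P : geomTorsion W ((p : ℤ) ^ m), ∃ k : ℕ, p ^ k • P = 0 := fun P ↦
    ⟨m, Subtype.ext (by
      rw [AddSubgroupClass.coe_nsmul, ZeroMemClass.coe_zero, ← natCast_zsmul, Nat.cast_pow]
      exact P.2)⟩
  obtain ⟨n, hn, y, hy⟩ := ZpExtension.exists_mem_range_resOfLe_of_le κ (geomTorsion W ((p : ℤ) ^ m))
    (fun P ↦ isOpen_stabilizer_geomTorsion W _ P) hprim n₀ s'
  refine ⟨n, m, hn, hm, y, ?_⟩
  have e := resH1Hom_comp (N := geomTorsion W ((p : ℤ) ^ m))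
    (subgroupInclusion (κ.kerSubgroup_le_layerSubgroup n)) (AddMonoidHom.id _) (fun _ _ ↦ rfl)
    (P := W.geomPrimaryTorsion p) (ContinuousMonoidHom.id κ.kerSubgroup)
    (AddSubgroup.inclusion (AcSigned.geomTorsion_zpow_le_geomPrimaryTorsion W p m)) (fun _ _ ↦ rfl)
  have e' : AcSigned.toInfty W p κ n m =
      (resH1Hom (ContinuousMonoidHom.id κ.kerSubgroup)
        (AddSubgroup.inclusion (AcSigned.geomTorsion_zpow_le_geomPrimaryTorsion W p m)) (fun _ _ ↦ rfl)).comp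
      (Literature.NumberTheory.EllipticCurves.resOfLe (geomTorsion W ((p : ℤ) ^ m))
        (κ.kerSubgroup_le_layerSubgroup n)) := by
    rw [AcSigned.toInfty, Literature.NumberTheory.EllipticCurves.resOfLe, e]
    exact resH1Hom_congr (ContinuousMonoidHom.ext fun _ ↦ rfl) (AddMonoidHom.ext fun _ ↦ rfl) _ _
  rw [e', AddMonoidHom.comp_apply, hy, hs']

end WeierstrassCurve

end
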